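import Mathlib
import Summits.Ventures.DiscreteObjects.Mahler.DobrowolskiDeterminant
import Summits.Ventures.DiscreteObjects.Mahler.SmallMeasureCensus

/-!
# Dobrowolski's theorem, analytic part: `log M(f) ≥ (1/2000)(log log d/log d)³` for nondegenerate `f` (venture `DiscreteObjects`, target L)

Cell `pub-namedobj`, seat `pub-namedobj-mahler-g27`. Framing: lottery ticket; floor = certified bounds/negative ranges.

[cite: MckeeSmyth2021, Theorem 3.1, §3.2 from (3.10) on] (Dobrowolski 1979; Cantor–Straus 1982): the determinant
inequality `(∏ q_j)^{2dS} ≤ N^{d(S²+T)} M^{2(N-1)(S+Σq_j)}` (`DobrowolskiDeterminant`) with the primes `q_j ≤ Y`, in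
logarithmic form `2 S θ(Y) ≤ (S² + π(Y))(log d + log(S + π(Y))) + 2 (S + π(Y)) (S + Y π(Y)) log M(f)`
(`dobrowolski_log_ineq`, Chebyshev's `θ` and `π` from Mathlib); the choice `S = ⌊6u/ℓ⌋`, `Y = ⌊36u²/ℓ⌋` (`u = log d`,
`ℓ = log u`) together with Chebyshev's bounds `θ(y) ≥ 0.6 y`, `π(y) ≤ 1.6 y / log y` for large `y` (from Mathlib's
`Chebyshev.theta_ge'`, `Chebyshev.eventually_primeCounting_le`) yields **`log M(f) ≥ (1/2000) (log log d / log d)³` for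
every monic irreducible NONDEGENERATE `f ∈ ℤ[X]` with `M(f) > 1` and `d = deg f` large** (`dobrowolski_of_nondegenerate`).
The printed constant is `2 - ε` (Dobrowolski: `1 - ε`) via the Prime Number Theorem and the optimal `S ~ u/ℓ, T ~ S²/2`;
with Chebyshev-strength input and no optimisation we record the explicit but unoptimised `1/2000`.  The unconditional
theorem (degenerate `f` by [MckeeSmyth2021, Lemma 3.8], small degrees by the weak bound) is `DobrowolskiTheorem`.
REPLICATION, no new mathematics.
-/

namespace Summit.Ventures.DiscreteObjects.Mahler

open Polynomial Finset Filter Real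

/-! ### The determinant inequality in logarithmic form, primes `≤ Y` -/

/-- **[MckeeSmyth2021, (3.10)] with Chebyshev's functions.**  For `f ∈ ℤ[X]` monic, irreducible, nondegenerate, with
`M(f) > 1` and degree `d`, and naturals `S ≥ 1`, `Y`:
`2 S θ(Y) ≤ (S² + π(Y)) (log d + log (S + π(Y))) + 2 (S + π(Y)) (S + Y π(Y)) log M(f)`. -/
theorem dobrowolski_log_ineq (f : ℤ[X]) (hmon : f.Monic) (hirr : Irreducible f) (hM : 1 < intMahlerMeasure f)
    (hnd : ∀ a ∈ (f.map (Int.castRingHom ℂ)).roots, ∀ b ∈ (f.map (Int.castRingHom ℂ)).roots, a ≠ b →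
      ∀ n : ℕ, 0 < n → a ^ n ≠ b ^ n)
    (S Y : ℕ) (hS : 1 ≤ S) :
    2 * (S : ℝ) * Chebyshev.theta Y ≤
      ((S : ℝ) ^ 2 + Nat.primeCounting Y) * (Real.log f.natDegree + Real.log ((S : ℝ) + Nat.primeCounting Y)) +
        2 * ((S : ℝ) + Nat.primeCounting Y) * ((S : ℝ) + Y * Nat.primeCounting Y) *
          Real.log (intMahlerMeasure f) := by
  classical
  set P := Nat.primesLE Y with hP
  set T := P.card with hT
  have hTπ : T = Nat.primeCounting Y := Nat.primesLE_card_eq_primeCounting Y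
  let q : Fin T → ℕ := fun j => ((P.equivFin.symm j : P) : ℕ)
  have hqmem : ∀ j, q j ∈ P := fun j => (P.equivFin.symm j).2
  have hq : ∀ j, (q j).Prime := fun j => Nat.prime_of_mem_primesLE (hqmem j)
  have hqle : ∀ j, q j ≤ Y := fun j => Nat.le_of_mem_primesLE (hqmem j)
  have hqinj : Function.Injective q := fun a b h => P.equivFin.symm.injective (Subtype.ext h)
  have hmain := prime_prod_pow_le_of_nondegenerate f hmon hirr hM hnd S q hq hqinj
  set d := f.natDegree with hd
  have hdpos : 0 < d := natDegree_pos_of_one_lt_measure hmon hM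
  set μ := Real.log (intMahlerMeasure f) with hμ
  have hμ0 : 0 ≤ μ := Real.log_nonneg hM.le
  have hM0 : 0 < intMahlerMeasure f := lt_trans zero_lt_one hM
  -- the sums over the primes
  have hsumlog : ∑ j, Real.log (q j) = Chebyshev.theta Y := by
    rw [Chebyshev.theta_eq_sum_primesLE_log, ← hP, ← Finset.sum_coe_sort P]
    exact Fintype.sum_equiv P.equivFin.symm (fun j => Real.log (q j)) (fun p : P => Real.log (p : ℕ)) (fun j => rfl)
  have hsumq : (∑ j, (q j : ℝ)) ≤ Y * T := by
    calc (∑ j, (q j : ℝ)) ≤ ∑ _j : Fin T, (Y : ℝ) := Finset.sum_le_sum fun j _ => by exact_mod_cast hqle j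
      _ = Y * T := by rw [Finset.sum_const, Finset.card_univ, Fintype.card_fin, nsmul_eq_mul, mul_comm]
  have hqpos : 0 < ∏ j, (q j : ℝ) := Finset.prod_pos fun j _ => by exact_mod_cast (hq j).pos
  -- logarithms of the two sides
  have hlogA : Real.log (((∏ j, (q j : ℝ)) ^ d) ^ (2 * S)) = 2 * S * (d * Chebyshev.theta Y) := by
    rw [Real.log_pow, Real.log_pow, Real.log_prod (s := Finset.univ) (fun j _ => by exact_mod_cast (hq j).ne_zero), hsumlog]
    push_cast
    ring
  set N := d * (S + T) with hN
  have hNpos : 0 < N := Nat.mul_pos hdpos (by omega)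
  have hlogB : Real.log (((N : ℕ) : ℝ) ^ (d * (S ^ 2 + T)) * intMahlerMeasure f ^ (2 * (N - 1) * (S + ∑ j, q j))) =
      (d * (S ^ 2 + T) : ℕ) * Real.log N + (2 * (N - 1) * (S + ∑ j, q j) : ℕ) * μ := by
    rw [Real.log_mul (by positivity) (by positivity), Real.log_pow, Real.log_pow]
  have hle := Real.log_le_log (by positivity) hmain
  rw [hlogA, hlogB] at hle
  -- simplify: `log N = log d + log (S + T)`, `N - 1 ≤ d (S + T)`, `Σ q ≤ Y T`
  have hlogN : Real.log (N : ℝ) = Real.log d + Real.log ((S : ℝ) + T) := by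
    rw [hN]; push_cast
    rw [Real.log_mul (by exact_mod_cast hdpos.ne') (by positivity)]
  have h2 : ((2 * (N - 1) * (S + ∑ j, q j) : ℕ) : ℝ) * μ ≤ 2 * (d * ((S : ℝ) + T)) * ((S : ℝ) + Y * T) * μ := by
    apply mul_le_mul_of_nonneg_right _ hμ0
    have hN1 : ((N - 1 : ℕ) : ℝ) ≤ d * ((S : ℝ) + T) := by
      have : ((N - 1 : ℕ) : ℝ) ≤ (N : ℝ) := by exact_mod_cast Nat.sub_le N 1
      refine this.trans (le_of_eq ?_)
      rw [hN]; push_cast; ring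
    push_cast
    have hS0 : (0 : ℝ) ≤ S + ∑ j, (q j : ℝ) := by positivity
    calc (2 : ℝ) * ((N - 1 : ℕ) : ℝ) * (S + ∑ j, (q j : ℝ)) ≤ 2 * (d * ((S : ℝ) + T)) * (S + ∑ j, (q j : ℝ)) := by
          gcongr
      _ ≤ 2 * (d * ((S : ℝ) + T)) * ((S : ℝ) + Y * T) := by
          gcongr
  have h3 : 2 * (S : ℝ) * (d * Chebyshev.theta Y) ≤
      (d * ((S : ℝ) ^ 2 + T)) * (Real.log d + Real.log ((S : ℝ) + T)) +
        2 * (d * ((S : ℝ) + T)) * ((S : ℝ) + Y * T) * μ := by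
    rw [hlogN] at hle
    push_cast at hle h2
    linarith
  -- divide by `d`
  have hdR : (0 : ℝ) < d := by exact_mod_cast hdpos
  rw [← hTπ]
  have key : (d : ℝ) * (2 * (S : ℝ) * Chebyshev.theta Y) ≤
      (d : ℝ) * (((S : ℝ) ^ 2 + T) * (Real.log d + Real.log ((S : ℝ) + T)) +
        2 * ((S : ℝ) + T) * ((S : ℝ) + Y * T) * μ) := by
    linarith
  exact le_of_mul_le_mul_left key hdR

/-! ### Chebyshev-type inputs (Mathlib) in the form used -/

/-- Eventually `θ(y) ≥ 0.6 y` (from Mathlib's Chebyshev lower bound `θ(x) ≥ (x-1) log 2 - log(x+2) - 2√x log x`). -/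
theorem eventually_theta_ge : ∀ᶠ y : ℝ in atTop, 3 / 5 * y ≤ Chebyshev.theta y := by
  have h1 : ∀ᶠ y : ℝ in atTop, Real.log y ≤ 1 / 250 * y := by
    have h := Real.isLittleO_log_id_atTop.bound (show (0 : ℝ) < 1 / 250 by norm_num)
    filter_upwards [h, eventually_ge_atTop 1] with y hy hy1
    rw [Real.norm_of_nonneg (Real.log_nonneg hy1), id, Real.norm_of_nonneg (by linarith)] at hy
    exact hy
  have h2 : ∀ᶠ y : ℝ in atTop, Real.log y ≤ 1 / 25 * Real.sqrt y := by
    have h := (isLittleO_log_rpow_atTop (show (0 : ℝ) < 1 / 2 by norm_num)).bound (show (0 : ℝ) < 1 / 25 by norm_num)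
    filter_upwards [h, eventually_ge_atTop 1] with y hy hy1
    rw [Real.norm_of_nonneg (Real.log_nonneg hy1), Real.norm_of_nonneg (by positivity), ← Real.sqrt_eq_rpow] at hy
    exact hy
  filter_upwards [h1, h2, eventually_ge_atTop (200 : ℝ)] with y hy1 hy2 hy
  have hθ := Chebyshev.theta_ge' (x := y) (by linarith)
  have hlog2 : Real.log 2 < 0.6931471808 := Real.log_two_lt_d9
  have hlog2' : 0.6931471803 < Real.log 2 := Real.log_two_gt_d9
  have hy2' : Real.log (y + 2) ≤ Real.log 2 + Real.log y := by
    rw [← Real.log_mul (by norm_num) (by linarith)]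
    exact Real.log_le_log (by linarith) (by linarith)
  have hsq : Real.sqrt y * Real.sqrt y = y := Real.mul_self_sqrt (by linarith)
  have hs0 : 0 ≤ Real.sqrt y := Real.sqrt_nonneg y
  have h3 : 2 * Real.sqrt y * Real.log y ≤ 2 / 25 * y := by
    calc 2 * Real.sqrt y * Real.log y ≤ 2 * Real.sqrt y * (1 / 25 * Real.sqrt y) :=
          mul_le_mul_of_nonneg_left hy2 (by positivity)
      _ = 2 / 25 * (Real.sqrt y * Real.sqrt y) := by ring
      _ = 2 / 25 * y := by rw [hsq]
  have h4 : 0.6931471803 * (y - 1) ≤ Real.log 2 * (y - 1) := mul_le_mul_of_nonneg_right hlog2'.le (by linarith)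
  linarith

/-- Eventually `π(⌊y⌋) ≤ 1.6 y / log y` (Mathlib's Chebyshev upper bound with `ε = 1/5`). -/
theorem eventually_primeCounting_le' :
    ∀ᶠ y : ℝ in atTop, (Nat.primeCounting ⌊y⌋₊ : ℝ) ≤ 8 / 5 * y / Real.log y := by
  have h := Chebyshev.eventually_primeCounting_le (show (0 : ℝ) < 1 / 5 by norm_num)
  filter_upwards [h, eventually_ge_atTop 2] with y hy hy2
  refine hy.trans ?_
  have hlog4 : Real.log 4 + 1 / 5 ≤ 8 / 5 := by
    have : Real.log 4 = 2 * Real.log 2 := by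
      rw [show (4 : ℝ) = 2 ^ 2 by norm_num, Real.log_pow]; norm_num
    rw [this]
    have := Real.log_two_lt_d9
    linarith
  exact div_le_div_of_nonneg_right (mul_le_mul_of_nonneg_right hlog4 (by linarith)) (Real.log_nonneg (by linarith))

/-- The parameter `Y(u) = ⌊36 u² / log u⌋` tends to infinity (indeed `Y(u) ≥ u` for `u ≥ 3`). -/
theorem le_dobY {u : ℝ} (hu : 3 ≤ u) : u ≤ (⌊36 * u ^ 2 / Real.log u⌋₊ : ℝ) := by
  have hℓpos : 0 < Real.log u := Real.log_pos (by linarith)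
  have hℓu : Real.log u ≤ u := (Real.log_le_sub_one_of_pos (by linarith)).trans (by linarith)
  have h1 : 36 * u ≤ 36 * u ^ 2 / Real.log u := by
    rw [le_div_iff₀ hℓpos]
    nlinarith
  have h2 := Nat.sub_one_lt_floor (36 * u ^ 2 / Real.log u)
  linarith

/-- `Y(u) = ⌊36 u² / log u⌋ → ∞` as `u → ∞`. -/
theorem tendsto_dobY : Tendsto (fun u : ℝ => (⌊36 * u ^ 2 / Real.log u⌋₊ : ℝ)) atTop atTop := by
  refine tendsto_atTop_mono' atTop ?_ tendsto_id
  filter_upwards [eventually_ge_atTop (3 : ℝ)] with u hu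
  exact le_dobY hu

/-! ### The optimisation step (real arithmetic) -/

/-- The arithmetic of [MckeeSmyth2021, (3.10) ff.] with our constants: writing `w = u/ℓ`, the bounds
`6w - 1 ≤ s ≤ 6w`, `36wu - 1 ≤ y ≤ 36wu`, `0 ≤ t ≤ 57.6 w²`, `θ ≥ 0.6 y`, `L ≤ 1.05 u` and the main inequality
`2sθ ≤ (s² + t) L + 2(s+t)(s+yt) μ` force `μ ≥ (1/2000) (ℓ/u)³`. -/
theorem dobrowolski_arith {u ℓ s y t θ L μ : ℝ} (hℓ : 2 ≤ ℓ) (hu : 100 * ℓ ≤ u)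
    (hs1 : 6 * u / ℓ - 1 ≤ s) (hs2 : s ≤ 6 * u / ℓ) (hy1 : 36 * u ^ 2 / ℓ - 1 ≤ y) (hy2 : y ≤ 36 * u ^ 2 / ℓ)
    (ht0 : 0 ≤ t) (ht : t ≤ 288 / 5 * u ^ 2 / ℓ ^ 2) (hθ : 3 / 5 * y ≤ θ) (hL : L ≤ 21 / 20 * u) (hμ : 0 ≤ μ)
    (hmain : 2 * s * θ ≤ (s ^ 2 + t) * L + 2 * (s + t) * (s + y * t) * μ) :
    1 / 2000 * (ℓ / u) ^ 3 ≤ μ := by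
  have hℓpos : 0 < ℓ := by linarith
  set w := u / ℓ with hw
  have hwu : u = w * ℓ := by rw [hw]; field_simp
  have hw100 : 100 ≤ w := by rw [hw, le_div_iff₀ hℓpos]; linarith
  have hw0 : 0 ≤ w := by linarith
  have hupos : 0 < u := by linarith
  have hu1 : 200 ≤ u := by linarith
  have e1 : 6 * u / ℓ = 6 * w := by rw [hw]; ring
  have e2 : 36 * u ^ 2 / ℓ = 36 * w * u := by rw [hwu]; field_simp
  have e3 : 288 / 5 * u ^ 2 / ℓ ^ 2 = 288 / 5 * w ^ 2 := by rw [hwu]; field_simp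
  rw [e1] at hs1 hs2
  rw [e2] at hy1 hy2
  rw [e3] at ht
  -- monomial comparisons
  have hwu0 : 100 * 200 ≤ w * u := mul_le_mul hw100 hu1 (by norm_num) hw0
  have p1 : 100 * (w * u) ≤ w ^ 2 * u := by
    have := mul_le_mul_of_nonneg_right hw100 (show 0 ≤ w * u by positivity)
    nlinarith [this]
  have p2 : 200 * w ≤ w * u := by nlinarith [mul_le_mul_of_nonneg_left hu1 hw0]
  have p3 : 100 * w ≤ w ^ 2 := by nlinarith [mul_le_mul_of_nonneg_right hw100 hw0]
  have p4 : 15 * w ≤ w ^ 3 * u := by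
    have q1 : 15 ≤ w ^ 2 * u := by nlinarith
    nlinarith [mul_le_mul_of_nonneg_left q1 hw0]
  have hs0 : 0 ≤ s := by linarith
  have hy0 : 0 ≤ y := by linarith
  have hθ0 : 0 ≤ θ := by linarith
  -- numerator
  have hN1 : 2 * (6 * w - 1) * (3 / 5 * (36 * w * u - 1)) ≤ 2 * s * θ := by
    have a1 : 3 / 5 * (36 * w * u - 1) ≤ θ := by linarith
    have a0 : 0 ≤ 3 / 5 * (36 * w * u - 1) := by linarith
    calc 2 * (6 * w - 1) * (3 / 5 * (36 * w * u - 1)) ≤ 2 * s * (3 / 5 * (36 * w * u - 1)) := by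
          apply mul_le_mul_of_nonneg_right _ a0
          linarith
      _ ≤ 2 * s * θ := mul_le_mul_of_nonneg_left a1 (by linarith)
  have hN2 : (s ^ 2 + t) * L ≤ (36 * w ^ 2 + 288 / 5 * w ^ 2) * (21 / 20 * u) := by
    have b1 : s ^ 2 ≤ 36 * w ^ 2 := by
      calc s ^ 2 ≤ (6 * w) ^ 2 := pow_le_pow_left₀ hs0 hs2 2
        _ = 36 * w ^ 2 := by ring
    have b0 : 0 ≤ s ^ 2 + t := by positivity
    calc (s ^ 2 + t) * L ≤ (s ^ 2 + t) * (21 / 20 * u) := mul_le_mul_of_nonneg_left hL b0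
      _ ≤ (36 * w ^ 2 + 288 / 5 * w ^ 2) * (21 / 20 * u) := by
          apply mul_le_mul_of_nonneg_right _ (by linarith)
          linarith
  have hNum : 150 * (w ^ 2 * u) ≤ 2 * s * θ - (s ^ 2 + t) * L := by
    have expand : 2 * (6 * w - 1) * (3 / 5 * (36 * w * u - 1)) =
        1296 / 5 * (w ^ 2 * u) - 36 / 5 * w - 216 / 5 * (w * u) + 6 / 5 := by ring
    have expand2 : (36 * w ^ 2 + 288 / 5 * w ^ 2) * (21 / 20 * u) = 2457 / 25 * (w ^ 2 * u) := by ring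
    rw [expand] at hN1
    rw [expand2] at hN2
    linarith
  -- denominator
  have hD1 : s + t ≤ 58 * w ^ 2 := by linarith
  have hD2 : s + y * t ≤ 2074 * (w ^ 3 * u) := by
    have c1 : y * t ≤ 36 * w * u * (288 / 5 * w ^ 2) := mul_le_mul hy2 ht ht0 (by positivity)
    have c2 : 36 * w * u * (288 / 5 * w ^ 2) = 10368 / 5 * (w ^ 3 * u) := by ring
    rw [c2] at c1
    linarith
  have hD : 2 * (s + t) * (s + y * t) * μ ≤ 2 * (58 * w ^ 2) * (2074 * (w ^ 3 * u)) * μ := by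
    apply mul_le_mul_of_nonneg_right _ hμ
    have d0 : 0 ≤ s + t := by linarith
    have d1 : 0 ≤ s + y * t := by positivity
    calc 2 * (s + t) * (s + y * t) ≤ 2 * (58 * w ^ 2) * (s + y * t) := by
          apply mul_le_mul_of_nonneg_right _ d1
          linarith
      _ ≤ 2 * (58 * w ^ 2) * (2074 * (w ^ 3 * u)) := by
          apply mul_le_mul_of_nonneg_left hD2
          positivity
  -- combine
  have hc : 150 * (w ^ 2 * u) ≤ 2 * (58 * w ^ 2) * (2074 * (w ^ 3 * u)) * μ := by linarith
  have hc2 : (w ^ 2 * u) * 150 ≤ (w ^ 2 * u) * (240584 * (w ^ 3 * μ)) := by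
    have e : 2 * (58 * w ^ 2) * (2074 * (w ^ 3 * u)) * μ = (w ^ 2 * u) * (240584 * (w ^ 3 * μ)) := by ring
    rw [← e]
    linarith
  have hc3 : 150 ≤ 240584 * (w ^ 3 * μ) := le_of_mul_le_mul_left hc2 (by positivity)
  have hw3 : 0 < w ^ 3 := by positivity
  have hlu : ℓ / u = 1 / w := by rw [hw, one_div_div]
  rw [hlu]
  have : 1 / 2000 * (1 / w) ^ 3 = (1 / 2000) / w ^ 3 := by ring
  rw [this, div_le_iff₀ hw3]
  linarith

/-! ### Eventual validity of the parameter choice `S = ⌊6u/ℓ⌋`, primes `≤ Y = ⌊36u²/ℓ⌋` -/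

/-- For `u` (= `log d`) large, with `ℓ = log u`, `S = ⌊6u/ℓ⌋ ≥ 1`, `Y = ⌊36u²/ℓ⌋`: every `μ ≥ 0` satisfying the
logarithmic determinant inequality satisfies `μ ≥ (1/2000)(ℓ/u)³`. -/
theorem dobrowolski_eventually : ∀ᶠ u : ℝ in atTop, 1 ≤ ⌊6 * u / Real.log u⌋₊ ∧ ∀ μ : ℝ, 0 ≤ μ →
    2 * (⌊6 * u / Real.log u⌋₊ : ℝ) * Chebyshev.theta (⌊36 * u ^ 2 / Real.log u⌋₊ : ℕ) ≤
      ((⌊6 * u / Real.log u⌋₊ : ℝ) ^ 2 + Nat.primeCounting ⌊36 * u ^ 2 / Real.log u⌋₊) *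
          (u + Real.log ((⌊6 * u / Real.log u⌋₊ : ℝ) + Nat.primeCounting ⌊36 * u ^ 2 / Real.log u⌋₊)) +
        2 * ((⌊6 * u / Real.log u⌋₊ : ℝ) + Nat.primeCounting ⌊36 * u ^ 2 / Real.log u⌋₊) *
          ((⌊6 * u / Real.log u⌋₊ : ℝ) + (⌊36 * u ^ 2 / Real.log u⌋₊ : ℕ) * Nat.primeCounting ⌊36 * u ^ 2 / Real.log u⌋₊) *
            μ →
    1 / 2000 * (Real.log u / u) ^ 3 ≤ μ := by
  have U1 : ∀ᶠ u : ℝ in atTop, 2 ≤ Real.log u := Real.tendsto_log_atTop.eventually (eventually_ge_atTop 2)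
  have U2 : ∀ᶠ u : ℝ in atTop, 100 * Real.log u ≤ u := by
    have h := Real.isLittleO_log_id_atTop.bound (show (0 : ℝ) < 1 / 100 by norm_num)
    filter_upwards [h, eventually_ge_atTop 1] with u hu hu1
    rw [Real.norm_of_nonneg (Real.log_nonneg hu1), id, Real.norm_of_nonneg (by linarith)] at hu
    linarith
  have U3 : ∀ᶠ u : ℝ in atTop,
      3 / 5 * (⌊36 * u ^ 2 / Real.log u⌋₊ : ℝ) ≤ Chebyshev.theta (⌊36 * u ^ 2 / Real.log u⌋₊ : ℕ) :=
    tendsto_dobY.eventually eventually_theta_ge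
  have U4 : ∀ᶠ u : ℝ in atTop, (Nat.primeCounting ⌊36 * u ^ 2 / Real.log u⌋₊ : ℝ) ≤
      8 / 5 * (⌊36 * u ^ 2 / Real.log u⌋₊ : ℝ) / Real.log (⌊36 * u ^ 2 / Real.log u⌋₊ : ℝ) := by
    have h := tendsto_dobY.eventually eventually_primeCounting_le'
    filter_upwards [h] with u hu
    rwa [Nat.floor_natCast] at hu
  filter_upwards [U1, U2, U3, U4, eventually_ge_atTop (3 : ℝ)] with u h1 h2 h3 h4 h5
  set ℓ := Real.log u with hℓ
  set S := ⌊6 * u / ℓ⌋₊ with hS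
  set Y := ⌊36 * u ^ 2 / ℓ⌋₊ with hY
  set T := Nat.primeCounting Y with hT
  have hℓpos : 0 < ℓ := by linarith
  have hupos : 0 < u := by linarith
  have hul : 100 ≤ u / ℓ := by rw [le_div_iff₀ hℓpos]; linarith
  -- `S`
  have hs2 : (S : ℝ) ≤ 6 * u / ℓ := Nat.floor_le (by positivity)
  have hs1 : 6 * u / ℓ - 1 ≤ (S : ℝ) := (Nat.sub_one_lt_floor _).le
  have hS1 : 1 ≤ S := by
    rw [hS, Nat.one_le_floor_iff]
    have : 6 * u / ℓ = 6 * (u / ℓ) := by ring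
    rw [this]
    linarith
  refine ⟨hS1, fun μ hμ hmain => ?_⟩
  -- `Y`
  have hy2 : (Y : ℝ) ≤ 36 * u ^ 2 / ℓ := Nat.floor_le (by positivity)
  have hy1 : 36 * u ^ 2 / ℓ - 1 ≤ (Y : ℝ) := (Nat.sub_one_lt_floor _).le
  have hYu : u ≤ (Y : ℝ) := le_dobY h5
  have hlogY : ℓ ≤ Real.log (Y : ℝ) := Real.log_le_log hupos hYu
  -- `T`
  have ht0 : (0 : ℝ) ≤ T := Nat.cast_nonneg _
  have ht : (T : ℝ) ≤ 288 / 5 * u ^ 2 / ℓ ^ 2 := by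
    calc (T : ℝ) ≤ 8 / 5 * (Y : ℝ) / Real.log (Y : ℝ) := h4
      _ ≤ 8 / 5 * (Y : ℝ) / ℓ := div_le_div_of_nonneg_left (by positivity) hℓpos hlogY
      _ ≤ 8 / 5 * (36 * u ^ 2 / ℓ) / ℓ := by gcongr
      _ = 288 / 5 * u ^ 2 / ℓ ^ 2 := by
          field_simp
          ring
  -- `L`
  have hL : u + Real.log ((S : ℝ) + T) ≤ 21 / 20 * u := by
    have hSTpos : 0 < (S : ℝ) + T := by
      have : (1 : ℝ) ≤ S := by exact_mod_cast hS1
      linarith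
    have hST : (S : ℝ) + T ≤ u ^ 3 := by
      have a1 : 6 * u / ℓ ≤ 6 * u / 2 := div_le_div_of_nonneg_left (by positivity) (by norm_num) h1
      have a2 : 288 / 5 * u ^ 2 / ℓ ^ 2 ≤ 288 / 5 * u ^ 2 / 2 ^ 2 :=
        div_le_div_of_nonneg_left (by positivity) (by norm_num) (pow_le_pow_left₀ (by norm_num) h1 2)
      nlinarith
    have hlog := Real.log_le_log hSTpos hST
    rw [Real.log_pow] at hlog
    push_cast at hlog
    linarith
  exact dobrowolski_arith h1 h2 hs1 hs2 hy1 hy2 ht0 ht h3 hL hμ hmain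

/-- **Dobrowolski's bound for nondegenerate `f` of large degree** [cite: MckeeSmyth2021, Theorem 3.1, §3.2]:
there is `U₀` such that every monic irreducible nondegenerate `f ∈ ℤ[X]` with `M(f) > 1` and `log (deg f) ≥ U₀` has
`log M(f) ≥ (1/2000) · (log log d / log d)³`, `d = deg f`. -/
theorem dobrowolski_of_nondegenerate : ∃ U₀ : ℝ, ∀ f : ℤ[X], f.Monic → Irreducible f →
    1 < intMahlerMeasure f →
    (∀ a ∈ (f.map (Int.castRingHom ℂ)).roots, ∀ b ∈ (f.map (Int.castRingHom ℂ)).roots, a ≠ b →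
      ∀ n : ℕ, 0 < n → a ^ n ≠ b ^ n) →
    U₀ ≤ Real.log f.natDegree →
    1 / 2000 * (Real.log (Real.log f.natDegree) / Real.log f.natDegree) ^ 3 ≤ Real.log (intMahlerMeasure f) := by
  obtain ⟨U₀, hU⟩ := Filter.eventually_atTop.1 dobrowolski_eventually
  refine ⟨U₀, fun f hmon hirr hM hnd hu => ?_⟩
  obtain ⟨hS, h⟩ := hU _ hu
  refine h _ (Real.log_nonneg hM.le) ?_
  exact dobrowolski_log_ineq f hmon hirr hM hnd _ _ hS

end Summit.Ventures.DiscreteObjects.Mahler
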